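import Literature.Topology.FourManifolds.InteriorManifold
import HarnessLib

/-!
# Extension by the identity of compactly supported diffeomorphisms of the interior

Topic `Literature/Topology/FourManifolds` (general differential topology; brick [A6] of the
discharge of `Literature.Topology.FourManifolds.nonempty_diffeomorph_of_isOrientedConnectedSum` at
arbitrary models, see `ConnectedSumUniquenessProofs.lean`).

Let `M` be a Hausdorff `C^∞` manifold modelled on an arbitrary real model with corners `I`, and
`X = InteriorManifold I M` its boundaryless interior manifold (`InteriorManifold.lean`, an open
smooth embedding `val : X → M` onto `I.interior M`). A diffeomorphism `f` of `X` which is the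
identity outside a compact set `K ⊆ X` extends by the identity to a diffeomorphism `F` of `M`
(for the model `I`), with `F ∘ val = val ∘ f` and `F = id` off `val '' K`
(`Literature.Topology.FourManifolds.InteriorManifold.exists_diffeomorph_extend`). This is the
static form of the standard remark that a diffeotopy of `Int M` with compact support extends by
the identity over `∂M` (Hirsch, *Differential Topology* (1976), Ch. 8 §1, Thm. 1.3 and the proof
of Thm. 3.1: "an isotopy … can be realized by a diffeotopy of `M` having compact support";
Kosinski, *Differential Manifolds* (1993), VI.1, discs in `Int M`). Smoothness of `F` at points of
`val '' K` holds because there `F = val ∘ f ∘ val⁻¹` on the open set `I.interior M`, and `val⁻¹`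
is smooth as a map *into* the interior (`InteriorManifold.contMDiffOn_iff_comp_val`); elsewhere
`F` is the identity near the point (`val '' K` is compact, hence closed).

Everything is proved; no named facts.

## References

* M. W. Hirsch, *Differential Topology*, GTM 33 (1976), Ch. 8 §1, Thm. 1.3; §3, Thm. 3.1.
  [HirschDT1976]
* A. Kosinski, *Differential Manifolds* (1993), Ch. VI §1. [Kosinski1993]
-/

open scoped Manifold ContDiff Topology
open Set Function Filter

noncomputable section

namespace Literature.Topology.FourManifolds

namespace InteriorManifold

variable {E H : Type*} [NormedAddCommGroup E] [NormedSpace ℝ E] [TopologicalSpace H]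
  {I : ModelWithCorners ℝ E H} {M : Type*} [TopologicalSpace M] [ChartedSpace H M]

open Classical in
/-- **Extension by the identity** of a self-map `f` of the interior manifold to a self-map of
`M`: `p ↦ f p` at interior points, `p ↦ p` at boundary points. [folklore] -/
def extendByID (f : InteriorManifold I M → InteriorManifold I M) (p : M) : M :=
  if h : I.IsInteriorPoint p then (f ⟨p, h⟩).val else p

/-- On the interior the extension is `f`: `extendByID f x.val = (f x).val`. [folklore] -/
@[simp] theorem extendByID_val (f : InteriorManifold I M → InteriorManifold I M)
    (x : InteriorManifold I M) : extendByID f x.val = (f x).val := by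
  simp [extendByID, x.property]

/-- At boundary points the extension is the identity. [folklore] -/
theorem extendByID_of_not_isInteriorPoint (f : InteriorManifold I M → InteriorManifold I M)
    {p : M} (hp : ¬ I.IsInteriorPoint p) : extendByID f p = p := by
  simp [extendByID, hp]

/-- Off `val '' K` the extension of a map supported in `K` is the identity. [folklore] -/
theorem extendByID_eq_self {f : InteriorManifold I M → InteriorManifold I M}
    {K : Set (InteriorManifold I M)} (hf : ∀ x ∉ K, f x = x) {p : M} (hp : p ∉ val '' K) :
    extendByID f p = p := by
  by_cases h : I.IsInteriorPoint p
  · have hx : (⟨p, h⟩ : InteriorManifold I M) ∉ K := fun hK => hp ⟨_, hK, rfl⟩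
    rw [show p = (⟨p, h⟩ : InteriorManifold I M).val from rfl, extendByID_val, hf _ hx]
  · exact extendByID_of_not_isInteriorPoint f h

/-- Extensions of mutually inverse maps are mutually inverse. [folklore] -/
theorem extendByID_extendByID {f g : InteriorManifold I M → InteriorManifold I M}
    (hgf : ∀ x, g (f x) = x) (p : M) : extendByID g (extendByID f p) = p := by
  by_cases h : I.IsInteriorPoint p
  · rw [show p = (⟨p, h⟩ : InteriorManifold I M).val from rfl, extendByID_val, extendByID_val, hgf]
  · rw [extendByID_of_not_isInteriorPoint f h, extendByID_of_not_isInteriorPoint g h]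

open Classical in
/-- A (non-canonical) retraction of `M` onto the interior manifold used to express the extension
near an interior point: `p ↦ ⟨p, _⟩` at interior points, a fixed point `x₀` elsewhere.
[folklore] -/
def toInterior (x₀ : InteriorManifold I M) (p : M) : InteriorManifold I M :=
  if h : I.IsInteriorPoint p then ⟨p, h⟩ else x₀

/-- `toInterior x₀` is a left inverse of `val`. [folklore] -/
@[simp] theorem toInterior_val (x₀ x : InteriorManifold I M) : toInterior x₀ x.val = x := by
  ext; simp [toInterior, x.property]

/-- On the interior, `val ∘ toInterior x₀ = id`. [folklore] -/
theorem val_toInterior_of_mem (x₀ : InteriorManifold I M) {p : M} (hp : p ∈ I.interior M) :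
    (toInterior x₀ p).val = p := by
  have h : I.IsInteriorPoint p := hp
  simp [toInterior, h]

/-- On the interior the extension of `f` is `val ∘ f ∘ toInterior x₀`. [folklore] -/
theorem extendByID_eq_comp_of_mem (f : InteriorManifold I M → InteriorManifold I M)
    (x₀ : InteriorManifold I M) {p : M} (hp : p ∈ I.interior M) :
    extendByID f p = (f (toInterior x₀ p)).val := by
  have h : I.IsInteriorPoint p := hp
  simp [extendByID, toInterior, h]

variable [IsManifold I ∞ M]

/-- The retraction `toInterior x₀` is `C^∞` on the interior, as a map into the interior manifold
(`val ∘ toInterior x₀ = id` there, `contMDiffOn_iff_comp_val`). [folklore] -/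
theorem contMDiffOn_toInterior (x₀ : InteriorManifold I M) :
    ContMDiffOn I 𝓘(ℝ, E) ∞ (toInterior x₀) (I.interior M) := by
  rw [contMDiffOn_iff_comp_val]
  exact contMDiffOn_id.congr fun p hp => val_toInterior_of_mem x₀ hp

/-- **The extension by the identity of a `C^∞` self-map of the interior with compact support is
`C^∞` on `M`** (`M` Hausdorff): near `val '' K` it is `val ∘ f ∘ toInterior` on the open interior,
elsewhere the identity near the point. [folklore] -/
theorem contMDiff_extendByID [T2Space M] {f : InteriorManifold I M → InteriorManifold I M}
    (hfs : ContMDiff 𝓘(ℝ, E) 𝓘(ℝ, E) ∞ f) {K : Set (InteriorManifold I M)} (hK : IsCompact K)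
    (hf : ∀ x ∉ K, f x = x) : ContMDiff I I ∞ (extendByID f) := by
  intro p
  have hKc : IsClosed (val '' K) := (hK.image continuous_val).isClosed
  by_cases hp : p ∈ val '' K
  · -- `p` is an interior point; work on the open interior
    obtain ⟨x, hxK, rfl⟩ := hp
    have hU : I.interior M ∈ 𝓝 x.val := isOpen_interior_carrier.mem_nhds x.val_mem_interior
    have h1 : ContMDiffOn I I ∞ (val ∘ f ∘ toInterior x) (I.interior M) :=
      (contMDiff_val.comp hfs).comp_contMDiffOn (contMDiffOn_toInterior x)
    have h2 : ContMDiffOn I I ∞ (extendByID f) (I.interior M) :=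
      h1.congr fun p hp => extendByID_eq_comp_of_mem f x hp
    exact h2.contMDiffAt hU
  · -- off the support: the identity near `p`
    have hev : extendByID f =ᶠ[𝓝 p] id := by
      filter_upwards [hKc.isOpen_compl.mem_nhds hp] with q hq
      exact extendByID_eq_self hf hq
    exact contMDiffAt_id.congr_of_eventuallyEq hev

/-- **Extension by the identity of a compactly supported diffeomorphism of the interior**
(Hirsch, *Differential Topology* (1976), Ch. 8 §1, Thm. 1.3, and §3, proof of Thm. 3.1, static
form): a diffeomorphism `f` of the boundaryless interior manifold `InteriorManifold I M` of a
Hausdorff manifold with corners `M`, equal to the identity outside a compact set `K`, extends to a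
diffeomorphism `F` of `M` for the model `I`, with `F ∘ val = val ∘ f` and `F = id` off `val '' K`.
[folklore] -/
theorem exists_diffeomorph_extend [T2Space M]
    (f : InteriorManifold I M ≃ₘ⟮𝓘(ℝ, E), 𝓘(ℝ, E)⟯ InteriorManifold I M)
    {K : Set (InteriorManifold I M)} (hK : IsCompact K) (hf : ∀ x ∉ K, f x = x) :
    ∃ F : M ≃ₘ⟮I, I⟯ M, (∀ x : InteriorManifold I M, F x.val = (f x).val) ∧
      ∀ p ∉ val '' K, F p = p := by
  have hf' : ∀ x ∉ K, f.symm x = x := fun x hx => by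
    conv_lhs => rw [← hf x hx]
    exact f.symm_apply_apply x
  refine ⟨{ toFun := extendByID f
            invFun := extendByID f.symm
            left_inv := extendByID_extendByID f.symm_apply_apply
            right_inv := extendByID_extendByID f.apply_symm_apply
            contMDiff_toFun := contMDiff_extendByID f.contMDiff hK hf
            contMDiff_invFun := contMDiff_extendByID f.symm.contMDiff hK hf' },
    fun x => extendByID_val f x, fun p hp => extendByID_eq_self hf hp⟩

end InteriorManifold

end Literature.Topology.FourManifolds
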